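import Mathlib.Analysis.Calculus.MeanValue
import Mathlib.Analysis.SpecialFunctions.Trigonometric.Bounds
import Mathlib.Analysis.Complex.ExponentialBounds
import Summits.QuantumFields.BalabanUV.Beta.EriceFlowEnclosureLogMeanSeq

/-!
# Beta / EriceFlowEnclosureLogMeanEscape — THE LOGARITHMIC CUTOFF AVERAGE ESCAPES SCHMIDT'S CLASS: `a n = sin(log(n+1))` IS SLOWLY
# OSCILLATING (1-log-Lipschitz), BOUNDED, LOGARITHMICALLY SUMMABLE TO 0 (`Σ_{k≤N} sin(log k)∕k` is bounded: `−cos(log x)` telescopes), AND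
# DIVERGENT (it returns above 1∕2 and below −1∕2 beyond every index) — so NO Tauberian theorem «ℓ-mean → m + (SO) ⟹ a → m» holds
# (pure [folklore] SERVICE for the BARE ∕ CUTOFF side of rows L131–L142; imports P2 #54e; Mathlib's mean value inequality and trigonometric bounds).
#   §1 THE WITNESS — `|a n| ≤ 1`, `|a i − a N| ≤ log(i∕N)` for 1 ≤ N ≤ i (`witness_logLip`), hence (SO) (P2 #53a `slowlyOscillating_of_logLip`);
#      near every `y ≥ 1` the index `n = ⌊e^y⌋₊` has `|a n − sin y| ≤ e^{−y} ≤ e⁻¹` (`witness_near`), so with `y = ±π∕2 + 2π(N₀+1)`: a takes values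
#      `≥ 1∕2` and `≤ −1∕2` beyond every N₀ and **does not converge** (`witness_not_tendsto`);
#   §2 ITS LOGARITHMIC MEAN TENDS TO 0 — per unit cell `|sin(log k)∕k − (cos log k − cos log(k+1))| ≤ 2∕k²` (`cell_le`: the mean value inequality
#      twice, `|d∕dx (sin(log x)∕x)| ≤ 2∕x²`), so `|Σ_{n<N} sin(log(n+1))∕(n+1)| ≤ |1 − cos log(N+1)| + 2·Σ 1∕k² ≤ 6` (`witness_logSum_abs_le`) and
#      **`(Σ_{n<N} a n∕(n+1))∕H_N → 0`** (`witness_logMean_tendsto_zero`);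
#   §3 END **`logMean_escapes`**: ∃ a, (SO) ∧ bounded ∧ ℓ-mean → 0 ∧ ¬ convergent — in contrast with (C,1) (P2 #53a), Abel (P2 #54b) and every
#      power weight (P2 #54d), where the same class forces convergence; the logarithmic Tauberian class is slow decrease on the POWER scales
#      N → N^λ (Kwee ∕ Móricz, in the tree), which `sin(log(n+1))` violates (it oscillates fully on [N, N^λ]).
# (β-flow team, prover 2 = lower ∕ positivity side, unit `b2b-balaban-beta-bflow-p2`, gen 37; module P2 #54f; no Erice sentence occurs)

HONEST FRAMING (page 1 of everything the β sub-cell writes): discharging `BetaPertH` makes Bałaban's UV stability UNCONDITIONAL — a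
real constructive-QFT result; it is NOT the continuum limit and NOT the Clay problem.  HONEST DEPENDENCY (cell reorg 2026-08-19,
verbatim): «continuum YM on T⁴ ⇐ BetaPertH ∧ nine spine estimates (0/9 proved); BetaPertH ⇐ (D1) ∧ (D4) ∧ CAP+tail; G-an2-4 gates
asym, D1 and NE2/3/4.»  THIS MODULE DISCHARGES NOTHING and quotes nothing: [folklore] real analysis (a standard example separating the
logarithmic method from (C,1) inside the slowly oscillating class; cf. Hardy, Divergent Series §4.16, and the necessity half of Móricz, Studia
Math. 219 (2013), whose sufficiency half is IN THE TREE as `Literature.Analysis.Asymptotics.Moricz2013_corollary3_holds`).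

THE POINT.  In RG language (P2 #54g): sample a 1-log-Lipschitz bounded M at the two-loop clock, `M(h n) = sin(log(n+1))` for `h n = L₀∕(n+1)`;
its uniform-RG-time average cannot converge unless M does (P2 #53b), but its LOGARITHMIC RG-time average converges (to 0) although M has no
limit at 0⁺: averaging with the weight 1∕(n+1) — i.e. uniformly in log n = log log(cutoff) — is smoothing enough to manufacture a «datum».

WHAT THIS FILE PROVES (0 sorry, 0 def): §1 `witness_abs_le_one`, `witness_logLip`, `witness_slowlyOscillating`, `log_floor_exp_near`, `witness_near`,
`witness_ge_half`, `witness_le_neg_half`, **`witness_not_tendsto`**; §2 `hasDerivAt_sin_log_div`, `hasDerivAt_neg_cos_log`, `sin_log_div_sub_le`,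
`cell_le`, `sum_inv_sq_succ_le`, `sum_inv_sq_succ_le_two`, **`witness_logSum_abs_le`**, **`witness_logMean_tendsto_zero`**; §3 END **`logMean_escapes`**.
NOT CLAIMED: the exact value of the bounded sum; anything about β-functions (P2 #54g dresses the witness with a clock); `BetaPertH`; continuum; Clay.
-/

namespace Summit.QuantumFields.BalabanUV.Beta.EriceFlowEnclosureLogMeanEscape

open Finset Filter Topology
open Summit.QuantumFields.BalabanUV.Beta.EriceFlowEnclosureCesaroTauberianSeq
open Summit.QuantumFields.BalabanUV.Beta.EriceFlowEnclosureLogMeanSeq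

noncomputable section

/-! ## §1 The witness `a n = sin(log(n+1))`: slowly oscillating, bounded, divergent -/

/-- `|sin(log(n+1))| ≤ 1`. [folklore] -/
theorem witness_abs_le_one (n : ℕ) : |Real.sin (Real.log ((n : ℝ) + 1))| ≤ 1 := Real.abs_sin_le_one _

/-- THE WITNESS IS 1-LOG-LIPSCHITZ: for 1 ≤ N ≤ i, `|sin(log(i+1)) − sin(log(N+1))| ≤ log((i+1)∕(N+1)) ≤ log(i∕N)`. [folklore] -/
theorem witness_logLip : ∀ N i : ℕ, 1 ≤ N → N ≤ i →
    |Real.sin (Real.log ((i : ℝ) + 1)) - Real.sin (Real.log ((N : ℝ) + 1))| ≤ 1 * Real.log ((i : ℝ) / N) := by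
  intro N i hN hNi
  have hN0 : (0 : ℝ) < N := by exact_mod_cast hN
  have hNi' : (N : ℝ) ≤ i := by exact_mod_cast hNi
  have hi0 : (0 : ℝ) < i := by linarith
  have h1 := Real.abs_sin_sub_sin_le (Real.log ((i : ℝ) + 1)) (Real.log ((N : ℝ) + 1))
  have h2 : Real.log ((i : ℝ) + 1) - Real.log ((N : ℝ) + 1) = Real.log (((i : ℝ) + 1) / ((N : ℝ) + 1)) :=
    (Real.log_div (by positivity) (by positivity)).symm
  have h3 : 0 ≤ Real.log (((i : ℝ) + 1) / ((N : ℝ) + 1)) :=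
    Real.log_nonneg (by rw [le_div_iff₀ (by positivity)]; linarith)
  have h4 : Real.log (((i : ℝ) + 1) / ((N : ℝ) + 1)) ≤ Real.log ((i : ℝ) / N) := by
    refine Real.log_le_log (by positivity) ?_
    rw [div_le_div_iff₀ (by positivity) hN0]; nlinarith
  rw [h2, abs_of_nonneg h3] at h1
  linarith

/-- The witness is slowly oscillating (P2 #53a `slowlyOscillating_of_logLip` with K = 1, N₀ = 1). [folklore] -/
theorem witness_slowlyOscillating :
    ∀ ε > 0, ∃ q > (1:ℝ), ∃ N₀ : ℕ, ∀ N i : ℕ, N₀ ≤ N → N ≤ i → (i : ℝ) ≤ q * N →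
      |Real.sin (Real.log ((i : ℝ) + 1)) - Real.sin (Real.log ((N : ℝ) + 1))| ≤ ε :=
  slowlyOscillating_of_logLip (a := fun n : ℕ => Real.sin (Real.log ((n : ℝ) + 1))) one_pos le_rfl witness_logLip

/-- THE INDEX `n = ⌊e^y⌋₊` SITS LOGARITHMICALLY WITHIN `e^{−y}` OF y: `|log(⌊e^y⌋₊ + 1) − y| ≤ e^{−y}` (since `e^y < n + 1 ≤ e^y + 1` and
`log(1 + e^{−y}) ≤ e^{−y}`). [folklore] -/
theorem log_floor_exp_near (y : ℝ) : |Real.log ((⌊Real.exp y⌋₊ : ℝ) + 1) - y| ≤ Real.exp (-y) := by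
  have hey : 0 < Real.exp y := Real.exp_pos y
  have hlo : Real.exp y < (⌊Real.exp y⌋₊ : ℝ) + 1 := Nat.lt_floor_add_one _
  have hhi : (⌊Real.exp y⌋₊ : ℝ) + 1 ≤ Real.exp y + 1 := by linarith [Nat.floor_le hey.le]
  have ht : 0 < (⌊Real.exp y⌋₊ : ℝ) + 1 := by positivity
  have h1 : y < Real.log ((⌊Real.exp y⌋₊ : ℝ) + 1) := by
    have := Real.log_lt_log hey hlo; rwa [Real.log_exp] at this
  have h2 : Real.log ((⌊Real.exp y⌋₊ : ℝ) + 1) ≤ y + Real.exp (-y) := by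
    have h3 : Real.log ((⌊Real.exp y⌋₊ : ℝ) + 1) ≤ Real.log (Real.exp y + 1) := Real.log_le_log ht hhi
    have h4 : Real.log (Real.exp y + 1) = y + Real.log (1 + Real.exp (-y)) := by
      rw [show Real.exp y + 1 = Real.exp y * (1 + Real.exp (-y)) by
        rw [mul_add, mul_one, ← Real.exp_add, add_neg_cancel, Real.exp_zero]]
      rw [Real.log_mul hey.ne' (by positivity), Real.log_exp]
    have h5 : Real.log (1 + Real.exp (-y)) ≤ Real.exp (-y) := by
      have := Real.log_le_sub_one_of_pos (show 0 < 1 + Real.exp (-y) by positivity); linarith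
    linarith
  rw [abs_le]; constructor <;> linarith

/-- THE WITNESS NEAR `sin y`: for the index `n = ⌊e^y⌋₊`, `|sin(log(n+1)) − sin y| ≤ e^{−y}`. [folklore] -/
theorem witness_near (y : ℝ) :
    |Real.sin (Real.log ((⌊Real.exp y⌋₊ : ℝ) + 1)) - Real.sin y| ≤ Real.exp (-y) :=
  (Real.abs_sin_sub_sin_le _ _).trans (log_floor_exp_near y)

/-- BEYOND EVERY INDEX THE WITNESS RETURNS ABOVE 1∕2: with `y = π∕2 + (N₀+1)·2π` and `n = ⌊e^y⌋₊`: `N₀ ≤ n` and `1∕2 ≤ sin(log(n+1))`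
(`sin y = 1`, `e^{−y} ≤ e^{−1} ≤ 1∕2`). [folklore] -/
theorem witness_ge_half (N₀ : ℕ) : ∃ n : ℕ, N₀ ≤ n ∧ (1 : ℝ) / 2 ≤ Real.sin (Real.log ((n : ℝ) + 1)) := by
  set y : ℝ := Real.pi / 2 + ((N₀ + 1 : ℕ) : ℝ) * (2 * Real.pi) with hy
  have hpi := Real.two_le_pi
  have hy1 : 1 ≤ y := by rw [hy]; push_cast; nlinarith
  have hyN : (N₀ : ℝ) + 1 ≤ y := by rw [hy]; push_cast; nlinarith
  refine ⟨⌊Real.exp y⌋₊, ?_, ?_⟩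
  · have h1 : y + 1 ≤ Real.exp y := Real.add_one_le_exp y
    have h2 : Real.exp y < (⌊Real.exp y⌋₊ : ℝ) + 1 := Nat.lt_floor_add_one _
    exact_mod_cast (show (N₀ : ℝ) ≤ ⌊Real.exp y⌋₊ by linarith)
  · have hsin : Real.sin y = 1 := by rw [hy, Real.sin_add_nat_mul_two_pi, Real.sin_pi_div_two]
    have h := witness_near y
    rw [hsin] at h
    have he : Real.exp (-y) ≤ 1 / 2 := by
      have h1 : Real.exp (-y) ≤ Real.exp (-1) := Real.exp_le_exp.mpr (by linarith)
      have h2 : Real.exp (-1) ≤ 1 / 2 := by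
        rw [Real.exp_neg, inv_le_comm₀ (Real.exp_pos 1) (by norm_num)]
        have := Real.exp_one_gt_d9; norm_num at this ⊢; linarith
      linarith
    have := (abs_le.mp h).1
    linarith

/-- … AND BELOW −1∕2: with `y = −π∕2 + (N₀+1)·2π` (`sin y = −1`). [folklore] -/
theorem witness_le_neg_half (N₀ : ℕ) : ∃ n : ℕ, N₀ ≤ n ∧ Real.sin (Real.log ((n : ℝ) + 1)) ≤ -(1 : ℝ) / 2 := by
  set y : ℝ := -(Real.pi / 2) + ((N₀ + 1 : ℕ) : ℝ) * (2 * Real.pi) with hy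
  have hpi := Real.two_le_pi
  have hpi4 := Real.pi_le_four
  have hy1 : 1 ≤ y := by rw [hy]; push_cast; nlinarith
  have hyN : (N₀ : ℝ) + 1 ≤ y := by rw [hy]; push_cast; nlinarith
  refine ⟨⌊Real.exp y⌋₊, ?_, ?_⟩
  · have h1 : y + 1 ≤ Real.exp y := Real.add_one_le_exp y
    have h2 : Real.exp y < (⌊Real.exp y⌋₊ : ℝ) + 1 := Nat.lt_floor_add_one _
    exact_mod_cast (show (N₀ : ℝ) ≤ ⌊Real.exp y⌋₊ by linarith)
  · have hsin : Real.sin y = -1 := by rw [hy, Real.sin_add_nat_mul_two_pi, Real.sin_neg, Real.sin_pi_div_two]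
    have h := witness_near y
    rw [hsin] at h
    have he : Real.exp (-y) ≤ 1 / 2 := by
      have h1 : Real.exp (-y) ≤ Real.exp (-1) := Real.exp_le_exp.mpr (by linarith)
      have h2 : Real.exp (-1) ≤ 1 / 2 := by
        rw [Real.exp_neg, inv_le_comm₀ (Real.exp_pos 1) (by norm_num)]
        have := Real.exp_one_gt_d9; norm_num at this ⊢; linarith
      linarith
    have := (abs_le.mp h).2
    linarith

/-- **THE WITNESS DOES NOT CONVERGE** (it is ≥ 1∕2 and ≤ −1∕2 beyond every index). [folklore] -/
theorem witness_not_tendsto : ¬ ∃ L : ℝ, Tendsto (fun n : ℕ => Real.sin (Real.log ((n : ℝ) + 1))) atTop (𝓝 L) := by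
  rintro ⟨L, hL⟩
  obtain ⟨N₀, hN₀⟩ := Metric.tendsto_atTop.mp hL (1 / 4) (by norm_num)
  obtain ⟨n₁, hn₁, h₁⟩ := witness_ge_half N₀
  obtain ⟨n₂, hn₂, h₂⟩ := witness_le_neg_half N₀
  have d₁ := hN₀ n₁ hn₁
  have d₂ := hN₀ n₂ hn₂
  rw [Real.dist_eq] at d₁ d₂
  have e₁ := (abs_lt.mp d₁).2
  have e₂ := (abs_lt.mp d₂).1
  linarith

/-! ## §2 The logarithmic mean of the witness tends to 0 -/

/-- `d∕dx (sin(log x)∕x) = (cos(log x) − sin(log x))∕x²` for x > 0. [folklore] -/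
theorem hasDerivAt_sin_log_div {x : ℝ} (hx : 0 < x) :
    HasDerivAt (fun x : ℝ => Real.sin (Real.log x) / x) ((Real.cos (Real.log x) - Real.sin (Real.log x)) / x ^ 2) x := by
  have hx' : x ≠ 0 := hx.ne'
  have h1 : HasDerivAt (fun x : ℝ => Real.sin (Real.log x)) (Real.cos (Real.log x) * x⁻¹) x :=
    (Real.hasDerivAt_log hx').sin
  have h2 := h1.div (hasDerivAt_id' x) hx'
  refine h2.congr_deriv ?_
  field_simp

/-- `d∕dx (−cos(log x)) = sin(log x)∕x` for x > 0. [folklore] -/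
theorem hasDerivAt_neg_cos_log {x : ℝ} (hx : 0 < x) :
    HasDerivAt (fun x : ℝ => -Real.cos (Real.log x)) (Real.sin (Real.log x) / x) x := by
  have h1 := ((Real.hasDerivAt_log hx.ne').cos).neg
  have h2 : -(-Real.sin (Real.log x) * x⁻¹) = Real.sin (Real.log x) / x := by rw [div_eq_mul_inv]; ring
  rw [← h2]
  exact h1

/-- ON THE CELL [k, k+1], k ≥ 1: `|sin(log x)∕x − sin(log k)∕k| ≤ 2∕k²` (mean value inequality with `|f′| ≤ 2∕x² ≤ 2∕k²`). [folklore] -/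
theorem sin_log_div_sub_le {k : ℝ} (hk : 1 ≤ k) {x : ℝ} (hx : x ∈ Set.Icc k (k + 1)) :
    |Real.sin (Real.log x) / x - Real.sin (Real.log k) / k| ≤ 2 / k ^ 2 := by
  have hk0 : 0 < k := by linarith
  have hderiv : ∀ z ∈ Set.Icc k (k + 1), HasDerivWithinAt (fun x : ℝ => Real.sin (Real.log x) / x)
      ((Real.cos (Real.log z) - Real.sin (Real.log z)) / z ^ 2) (Set.Icc k (k + 1)) z :=
    fun z hz => (hasDerivAt_sin_log_div (by linarith [hz.1])).hasDerivWithinAt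
  have hbound : ∀ z ∈ Set.Icc k (k + 1), ‖(Real.cos (Real.log z) - Real.sin (Real.log z)) / z ^ 2‖ ≤ 2 / k ^ 2 := by
    intro z hz
    have hz0 : 0 < z := by linarith [hz.1]
    rw [Real.norm_eq_abs, abs_div, abs_of_pos (pow_pos hz0 2)]
    have h1 : |Real.cos (Real.log z) - Real.sin (Real.log z)| ≤ 2 := by
      have := Real.abs_cos_le_one (Real.log z); have := Real.abs_sin_le_one (Real.log z)
      have := abs_sub (Real.cos (Real.log z)) (Real.sin (Real.log z)); linarith
    have h2 : k ^ 2 ≤ z ^ 2 := by nlinarith [hz.1]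
    calc |Real.cos (Real.log z) - Real.sin (Real.log z)| / z ^ 2 ≤ 2 / z ^ 2 :=
          div_le_div_of_nonneg_right h1 (pow_pos hz0 2).le
      _ ≤ 2 / k ^ 2 := div_le_div_of_nonneg_left (by norm_num) (pow_pos hk0 2) h2
  have h := (convex_Icc k (k + 1)).norm_image_sub_le_of_norm_hasDerivWithin_le hderiv hbound
    (Set.left_mem_Icc.mpr (by linarith)) hx
  rw [Real.norm_eq_abs, Real.norm_eq_abs] at h
  have hxk : |x - k| ≤ 1 := by rw [abs_le]; constructor <;> linarith [hx.1, hx.2]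
  calc |Real.sin (Real.log x) / x - Real.sin (Real.log k) / k| ≤ 2 / k ^ 2 * |x - k| := h
    _ ≤ 2 / k ^ 2 * 1 := mul_le_mul_of_nonneg_left hxk (by positivity)
    _ = 2 / k ^ 2 := mul_one _

/-- **THE UNIT CELL**: for k ≥ 1, `|sin(log k)∕k − (cos(log k) − cos(log(k+1)))| ≤ 2∕k²` — the mean value inequality for
`G(x) = −cos(log x) − x·sin(log k)∕k`, whose derivative `sin(log x)∕x − sin(log k)∕k` is `≤ 2∕k²` on the cell by `sin_log_div_sub_le`. [folklore] -/
theorem cell_le {k : ℝ} (hk : 1 ≤ k) :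
    |Real.sin (Real.log k) / k - (Real.cos (Real.log k) - Real.cos (Real.log (k + 1)))| ≤ 2 / k ^ 2 := by
  have hk0 : 0 < k := by linarith
  have hderiv : ∀ z ∈ Set.Icc k (k + 1), HasDerivWithinAt (fun x : ℝ => -Real.cos (Real.log x) - x * (Real.sin (Real.log k) / k))
      (Real.sin (Real.log z) / z - Real.sin (Real.log k) / k) (Set.Icc k (k + 1)) z := by
    intro z hz
    have hz0 : 0 < z := by linarith [hz.1]
    have h1 := (hasDerivAt_neg_cos_log hz0).sub ((hasDerivAt_id z).mul_const (Real.sin (Real.log k) / k))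
    simp only [one_mul] at h1
    exact h1.hasDerivWithinAt
  have hbound : ∀ z ∈ Set.Icc k (k + 1), ‖Real.sin (Real.log z) / z - Real.sin (Real.log k) / k‖ ≤ 2 / k ^ 2 :=
    fun z hz => by rw [Real.norm_eq_abs]; exact sin_log_div_sub_le hk hz
  have h := (convex_Icc k (k + 1)).norm_image_sub_le_of_norm_hasDerivWithin_le hderiv hbound
    (Set.left_mem_Icc.mpr (by linarith)) (Set.right_mem_Icc.mpr (by linarith))
  rw [Real.norm_eq_abs, Real.norm_eq_abs, show k + 1 - k = (1 : ℝ) by ring, abs_one, mul_one] at h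
  have hid : -Real.cos (Real.log (k + 1)) - (k + 1) * (Real.sin (Real.log k) / k) -
      (-Real.cos (Real.log k) - k * (Real.sin (Real.log k) / k)) =
      -(Real.sin (Real.log k) / k - (Real.cos (Real.log k) - Real.cos (Real.log (k + 1)))) := by
    field_simp; ring
  rw [hid, abs_neg] at h
  exact h

/-- `Σ_{n<N} 1∕(n+1)² ≤ 2 − 1∕N` (telescoping `1∕k² ≤ 1∕(k−1) − 1∕k`; at N = 0 both sides read 0 ≤ 2). [folklore] -/
theorem sum_inv_sq_succ_le (N : ℕ) : ∑ n ∈ range N, (1 : ℝ) / ((n : ℝ) + 1) ^ 2 ≤ 2 - 1 / (N : ℝ) := by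
  induction N with
  | zero => simp
  | succ N ih =>
    rw [sum_range_succ]
    rcases Nat.eq_zero_or_pos N with hN | hN
    · subst hN; norm_num
    · have hN0 : (0 : ℝ) < N := by exact_mod_cast hN
      push_cast
      have key : 1 / ((N : ℝ) + 1) ^ 2 ≤ 1 / (N : ℝ) - 1 / ((N : ℝ) + 1) := by
        rw [div_sub_div _ _ hN0.ne' (by positivity), div_le_div_iff₀ (by positivity) (by positivity)]
        ring_nf; nlinarith
      linarith

/-- `Σ_{n<N} 1∕(n+1)² ≤ 2`. [folklore] -/
theorem sum_inv_sq_succ_le_two (N : ℕ) : ∑ n ∈ range N, (1 : ℝ) / ((n : ℝ) + 1) ^ 2 ≤ 2 := by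
  have h := sum_inv_sq_succ_le N
  have : 0 ≤ 1 / (N : ℝ) := by positivity
  linarith

/-- **THE LOGARITHMIC SUMS OF THE WITNESS ARE BOUNDED: `|Σ_{n<N} sin(log(n+1))∕(n+1)| ≤ 6`** (telescope `1 − cos(log(N+1))` plus the cell
errors `Σ 2∕k² ≤ 4`). [folklore] -/
theorem witness_logSum_abs_le (N : ℕ) :
    |∑ n ∈ range N, ((n : ℝ) + 1)⁻¹ * Real.sin (Real.log ((n : ℝ) + 1))| ≤ 6 := by
  -- the telescoping part
  have htel : ∑ n ∈ range N, (Real.cos (Real.log ((n : ℝ) + 1)) - Real.cos (Real.log ((n : ℝ) + 1 + 1))) =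
      1 - Real.cos (Real.log ((N : ℝ) + 1)) := by
    have h := Finset.sum_range_sub (fun i : ℕ => -Real.cos (Real.log ((i : ℝ) + 1))) N
    simp only [Nat.cast_zero, zero_add, Real.log_one, Real.cos_zero] at h
    rw [show (1 : ℝ) - Real.cos (Real.log ((N : ℝ) + 1)) = -Real.cos (Real.log ((N : ℝ) + 1)) - -1 by ring, ← h]
    refine sum_congr rfl fun n _ => ?_
    push_cast; ring
  -- the cell errors
  have hcell : ∀ n ∈ range N, |((n : ℝ) + 1)⁻¹ * Real.sin (Real.log ((n : ℝ) + 1)) -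
      (Real.cos (Real.log ((n : ℝ) + 1)) - Real.cos (Real.log ((n : ℝ) + 1 + 1)))| ≤ 2 * (1 / ((n : ℝ) + 1) ^ 2) := by
    intro n _
    have h := cell_le (k := (n : ℝ) + 1) (by have := (Nat.cast_nonneg n : (0:ℝ) ≤ n); linarith)
    rw [show ((n : ℝ) + 1)⁻¹ * Real.sin (Real.log ((n : ℝ) + 1)) = Real.sin (Real.log ((n : ℝ) + 1)) / ((n : ℝ) + 1) by
      rw [div_eq_mul_inv, mul_comm]]
    have : (2 : ℝ) / ((n : ℝ) + 1) ^ 2 = 2 * (1 / ((n : ℝ) + 1) ^ 2) := by ring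
    linarith
  have hdiff : |∑ n ∈ range N, ((n : ℝ) + 1)⁻¹ * Real.sin (Real.log ((n : ℝ) + 1)) -
      ∑ n ∈ range N, (Real.cos (Real.log ((n : ℝ) + 1)) - Real.cos (Real.log ((n : ℝ) + 1 + 1)))| ≤ 4 := by
    rw [← sum_sub_distrib]
    refine (abs_sum_le_sum_abs _ _).trans ?_
    refine (sum_le_sum hcell).trans ?_
    rw [← mul_sum]
    have := sum_inv_sq_succ_le_two N
    linarith
  have hcos := Real.abs_cos_le_one (Real.log ((N : ℝ) + 1))
  have htel' : |∑ n ∈ range N, (Real.cos (Real.log ((n : ℝ) + 1)) - Real.cos (Real.log ((n : ℝ) + 1 + 1)))| ≤ 2 := by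
    rw [htel]
    have := abs_sub (1 : ℝ) (Real.cos (Real.log ((N : ℝ) + 1))); rw [abs_one] at this; linarith
  have := abs_sub_abs_le_abs_sub (∑ n ∈ range N, ((n : ℝ) + 1)⁻¹ * Real.sin (Real.log ((n : ℝ) + 1)))
    (∑ n ∈ range N, (Real.cos (Real.log ((n : ℝ) + 1)) - Real.cos (Real.log ((n : ℝ) + 1 + 1))))
  linarith

/-- **THE LOGARITHMIC MEAN OF THE WITNESS TENDS TO 0**: `(Σ_{n<N} sin(log(n+1))∕(n+1))∕H_N → 0` (`≤ 6∕H_N`, `H_N → ∞`). [folklore] -/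
theorem witness_logMean_tendsto_zero :
    Tendsto (fun N => (∑ n ∈ range N, ((n : ℝ) + 1)⁻¹ * Real.sin (Real.log ((n : ℝ) + 1))) /
      ∑ n ∈ range N, ((n : ℝ) + 1)⁻¹) atTop (𝓝 0) := by
  have h6 : Tendsto (fun N => (6 : ℝ) / ∑ n ∈ range N, ((n : ℝ) + 1)⁻¹) atTop (𝓝 0) :=
    tendsto_const_nhds.div_atTop logMass_tendsto_atTop
  refine squeeze_zero_norm' ?_ h6
  filter_upwards [eventually_ge_atTop 1] with N hN
  have hH := logMass_pos hN
  rw [Real.norm_eq_abs, abs_div, abs_of_pos hH]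
  exact div_le_div_of_nonneg_right (witness_logSum_abs_le N) hH.le

/-! ## §3 END: the logarithmic method has no Tauberian theorem in Schmidt's class -/

/-- **THE LOGARITHMIC CUTOFF AVERAGE ESCAPES SCHMIDT'S CLASS (END).**  There is a real sequence — `a n = sin(log(n+1))` — which is slowly
oscillating, bounded (`|a n| ≤ 1`), logarithmically summable to 0, and NOT convergent.  Contrast: in the same class the (C,1) means (P2 #53a),
the Abel means (P2 #54b, bounded below) and every power-weighted mean `(n+1)^σ`, σ > −1 (P2 #54d) converge ONLY to the limit of the sequence.
[folklore] -/
theorem logMean_escapes : ∃ a : ℕ → ℝ,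
    (∀ ε > 0, ∃ q > (1:ℝ), ∃ N₀ : ℕ, ∀ N i : ℕ, N₀ ≤ N → N ≤ i → (i : ℝ) ≤ q * N → |a i - a N| ≤ ε) ∧
    (∀ n, |a n| ≤ 1) ∧
    Tendsto (fun N => (∑ n ∈ range N, ((n : ℝ) + 1)⁻¹ * a n) / ∑ n ∈ range N, ((n : ℝ) + 1)⁻¹) atTop (𝓝 0) ∧
    ¬ ∃ L : ℝ, Tendsto a atTop (𝓝 L) :=
  ⟨fun n => Real.sin (Real.log ((n : ℝ) + 1)), witness_slowlyOscillating, witness_abs_le_one,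
    witness_logMean_tendsto_zero, witness_not_tendsto⟩

end

end Summit.QuantumFields.BalabanUV.Beta.EriceFlowEnclosureLogMeanEscape
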